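import Summits.NavierStokesRegularity.NavierStokesRegularity.Theses.TypeILiouville
import Summits.NavierStokesRegularity.NavierStokesRegularity.Theorems.TypeILiouvilleTypeIliouvilleNoTypeIIGradientPivotFastBallsEnergy
import HarnessLib

/-!
# Strategy census sketch — crux `TypeIliouvilleNoTypeII` (stmt-NavierStokesRegularity-0056)

Typed companions of `STRATEGY-CENSUS.md` (crux-strategist seat
`planner-cstrat-stmt-NavierStokesRegularity-0056-s1-0`, 2026-08-17).  Nothing here is a line or a
stub: the file only TYPES the best decomposition (D1) and the strengthenings (S⁺1, S⁺2) discussed in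
the census, and proves the bookkeeping implications from LANDED tree theorems, so that the census
statements are checked signatures rather than prose.  Sorry-free.
-/

noncomputable section

set_option linter.dupNamespace false

open Set Function Filter Topology MeasureTheory Metric

namespace Summit.NavierStokesRegularity.NavierStokesRegularity.Cruxes.TypeIliouvilleNoTypeII.StrategyCensus

open Literature.Analysis Literature.Analysis.FluidPDE
open Summit.NavierStokesRegularity.NavierStokesRegularity.Theses.TypeILiouville
open Summit.NavierStokesRegularity.NavierStokesRegularity.Theorems.TypeIliouvilleNoTypeII.GradientPivot

/-- `ℝ³`. -/
local notation "E3" => EuclideanSpace ℝ (Fin 3)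

/-! ## D1 — the best typed split: `crux ⇔ A ∧ E` (both directions LANDED, p141980) -/

/-- Piece **A** (`GradientBKMSharp`): BKM-sharp gradient rate for every maximal Leray–Hopf
solution from a rapidly decaying datum. Necessary for the crux (`gradientSharp_of_noTypeII`). -/
def GradientBKMSharp : Prop :=
  ∀ (ν T : ℝ), 0 < ν → 0 < T → ∀ (u : ℝ → E3 → E3) (p : ℝ → E3 → ℝ),
    IsMaximalSmoothSolution ν 0 u p T → IsLerayHopfOn T ν 0 (u 0) u →
    HasRapidSpatialDecay (u 0) →
    ∃ C : ℝ, ∀ᶠ t in 𝓝[<] T, ∀ x, ‖fderiv ℝ (u t) x‖ ≤ C / (T - t)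

/-- Piece **E** (`EnergyTypeIOfGradientSharp`): a gradient-sharp blow-up is Type I in the energy
sense — centre-free Seregin `A`-quantity bounded at the parabolic scale. Necessary for the crux
(`scaledEnergyTypeI_of_isTypeIBlowup`); under A equivalent to it
(`isTypeIBlowup_iff_scaledEnergyTypeI_of_gradientSharp`). -/
def EnergyTypeIOfGradientSharp : Prop :=
  ∀ (ν T : ℝ), 0 < ν → 0 < T → ∀ (u : ℝ → E3 → E3) (p : ℝ → E3 → ℝ),
    IsMaximalSmoothSolution ν 0 u p T → IsLerayHopfOn T ν 0 (u 0) u →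
    HasRapidSpatialDecay (u 0) →
    (∃ C₁ : ℝ, ∀ᶠ t in 𝓝[<] T, ∀ x, ‖fderiv ℝ (u t) x‖ ≤ C₁ / (T - t)) →
    ∃ K : ℝ, ∀ᶠ t in 𝓝[<] T, ∀ x : E3,
      ∫ y in ball x (Real.sqrt (T - t)), ‖u t y‖ ^ 2 ≤ K * Real.sqrt (T - t)

/-- The D1 assembly `A → E → crux` — a one-line consequence of the landed dictionary
`stub_noTypeII_iff_gradientSharp_and_scaledEnergyTypeI` (p141980). [folklore] -/
theorem TypeIliouvilleNoTypeII_of_subs :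
    GradientBKMSharp → EnergyTypeIOfGradientSharp → TypeIliouvilleNoTypeII :=
  fun hA hE => stub_noTypeII_iff_gradientSharp_and_scaledEnergyTypeI.mpr ⟨hA, hE⟩

/-- … and BOTH pieces are necessary: the split is an equivalence, so `A ∧ E` is the crux re-typed,
not reduced (census §Decomposition). [folklore] -/
theorem TypeIliouvilleNoTypeII_iff_subs :
    TypeIliouvilleNoTypeII ↔ GradientBKMSharp ∧ EnergyTypeIOfGradientSharp :=
  stub_noTypeII_iff_gradientSharp_and_scaledEnergyTypeI

/-! ## S⁺1 — uniform dimensionless Type-I constant -/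

/-- **S⁺1 (`UniformTypeI`)**: ONE dimensionless constant `M` bounds the Type-II excess
`√((T - t)/ν) ‖u(t)‖_∞` of every finite-energy blow-up from Schwartz data near its lifespan
(Leray's floor `c√ν/√(T - t)` has the same shape). Strictly stronger than the crux in form. -/
def UniformTypeI : Prop :=
  ∃ M : ℝ, ∀ (ν T : ℝ), 0 < ν → 0 < T → ∀ (u : ℝ → E3 → E3) (p : ℝ → E3 → ℝ),
    IsMaximalSmoothSolution ν 0 u p T → IsLerayHopfOn T ν 0 (u 0) u →
    HasRapidSpatialDecay (u 0) →
    ∀ᶠ t in 𝓝[<] T, ∀ x, ‖u t x‖ ≤ M * Real.sqrt ν / Real.sqrt (T - t)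

/-- `S⁺1 → crux` (trivial specialisation of the constant). [folklore] -/
theorem TypeIliouvilleNoTypeII_of_uniformTypeI : UniformTypeI → TypeIliouvilleNoTypeII := by
  rintro ⟨M, hM⟩ ν T hν hT u p hmax hLH hdec
  exact ⟨M * Real.sqrt ν, hM ν T hν hT u p hmax hLH hdec⟩

/-! ## S⁺2 — one-dyadic-step propagation of a Type-I bound (the "induction on scales" form) -/

/-- **S⁺2 (`DyadicPropagation`)**: there is a threshold `M` such that for every finite-energy
maximal solution from Schwartz data and every constant `K ≥ M`, a Type-I bound with constant `K`
on the dyadic time window `[t, T - (T - t)/2]` propagates to the next window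
`[T - (T - t)/2, T - (T - t)/4]`, for all `t < T` near `T`.  By induction on dyadic windows (base
case: boundedness of the classical solution on a closed sub-slab) it gives the crux; it is the
crux-level shadow of the contraction theses of routes `SqueezeCycle` / `DulacContraction`. -/
def DyadicPropagation : Prop :=
  ∃ M : ℝ, ∀ (ν T : ℝ), 0 < ν → 0 < T → ∀ (u : ℝ → E3 → E3) (p : ℝ → E3 → ℝ),
    IsMaximalSmoothSolution ν 0 u p T → IsLerayHopfOn T ν 0 (u 0) u →
    HasRapidSpatialDecay (u 0) →
    ∀ᶠ t in 𝓝[<] T, ∀ K : ℝ, M ≤ K →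
      (∀ s ∈ Icc t (T - (T - t) / 2), ∀ x, ‖u s x‖ ≤ K * Real.sqrt ν / Real.sqrt (T - s)) →
      ∀ s ∈ Icc (T - (T - t) / 2) (T - (T - t) / 4), ∀ x,
        ‖u s x‖ ≤ K * Real.sqrt ν / Real.sqrt (T - s)

end Summit.NavierStokesRegularity.NavierStokesRegularity.Cruxes.TypeIliouvilleNoTypeII.StrategyCensus

end
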